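import Literature.Analysis.FluidPDE.AxisymSmallSwirlSlice
import Literature.Analysis.FluidPDE.AxisymSwirlL2Bound
import Literature.Analysis.FluidPDE.HouLiSpaceTime
import HarnessLib

/-!
# Lei–Zhang 2017, Thm. 1.4 (first alternative): the continuity argument in Tao's class
# (`‖V²(t)‖² + ‖Ω(t)‖² ≤ ‖V₀²‖² + ‖Ω₀‖²` and `∫₀ᵀ ‖∇Ω‖² ≤ 2 E₀`)

Analysis/FluidPDE proof file (theorems only; no definitions, no named facts) on the discharge path
of the named fact `Literature.Analysis.FluidPDE.LeiZhang2017_smallSwirl_regularity`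
(Lei–Zhang 2017, Thm. 1.4), sequel of `AxisymSmallSwirlSlice.lean` and `AxisymSwirlL2Bound.lean`.

Lei–Zhang (arXiv:1505.02628, §4, p. 10): "Hence, under the condition of the theorem, there exists
`T > 0` such that `‖V²‖² + ‖Ω‖² < 2‖V₀²‖² + 2‖Ω₀‖²` … If `δ` is a suitably small positive constant and
`‖Γ₀‖_{L^∞} ≤ δ M₀⁻¹` is satisfied, then … `d/dt (‖V²‖² + ‖Ω‖²) ≤ 0` … The above argument implies,
by the standard continuation method that `‖V²‖² + ‖Ω‖² ≤ ‖V₀²‖² + ‖Ω₀‖²` for all `t ≥ 0`."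

* `IsTaoSolutionOn.energy_balance` — for a Tao-class solution with axisymmetric slices the energy
  `E(t) = ∫ (r²Φ(t)⁴ + Ω(t)²)` (`= ‖V²‖² + ‖Ω‖²`, `Φ = angVelQuot`, `Ω = angVortQuot`) is continuous
  on `[0, T]` and `E(b) = E(0) + ∫₀ᵇ (4∫ r²Φ³Φ' + 2∫ΩΩ')` (`IsSmoothSpaceTimeOn.l2_balance` for the
  vector field `(x₀Φ², x₁Φ², Ω)`, `∂ₜΦ = angVelQuot (∂ₜu)`, `∂ₜΩ = angVortQuot (∂ₜu)` by
  `HouLiSpaceTime`);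
* `IsTaoSolutionOn.smallSwirl_energy_le` — **the continuity argument**: if `|Γ₀| ≤ M`, `Γ₀ ∈ L²`,
  `E(0) < L` and `C_A (L · M² ‖Γ₀‖²_{L²})^{1/4} ≤ 1/3`, then `E(t) ≤ E(0)` for all `t ∈ [0, T]`
  and `∫₀ᵀ ‖∇Ω‖² ≤ 2 E(0)` (the slice inequality `IsTaoSolutionOn.smallSwirl_slice_le` at every
  time with `E(t) ≤ L`, using `‖Γ(t)‖₂ ≤ ‖Γ₀‖₂` and `|Γ(t)| ≤ M`; first exit time argument).

## Mathlib / tree search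

Tree: `IsTaoSolutionOn.smallSwirl_slice_le` (`AxisymSmallSwirlSlice`),
`IsTaoSolutionOn.lintegral_swirl_sq_le` (`AxisymSwirlL2Bound`), `IsTaoSolutionOn.abs_swirl_le`
(`SwirlMaximumPrinciple`), `IsSmoothSpaceTimeOn.angVelQuot_family / angVortQuot_family /
timeDerivWithin_angVelQuot / timeDerivWithin_angVortQuot` (`HouLiSpaceTime`),
`IsSmoothSpaceTimeOn.l2_balance` (`ClassicalL2Stability`), family `L²`/sup bounds
(`AxisymQuotientRayAverage`).  Mathlib: `Real.sInf` API (`csInf_le`, `le_csInf`), `setIntegral_nonpos`.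

## References

* Z. Lei, Q. S. Zhang, Pacific J. Math. 289 (2017) 169–187, arXiv:1505.02628, §4 (p. 10).
  [`LeiZhang2017`]
-/

noncomputable section

open MeasureTheory Set Function Filter Topology InnerProductSpace WithLp
open scoped RealInnerProductSpace Laplacian ContDiff ENNReal NNReal

namespace Literature.Analysis.FluidPDE

/-! ### The carrier vector `(x₀Φ², x₁Φ², Ω)` -/

section Carrier

/-- `⟪a e₀ + b e₁ + c e₂, a' e₀ + b' e₁ + c' e₂⟫ = aa' + bb' + cc'`. [folklore] -/
theorem inner_combo_three (a b c a' b' c' : ℝ) :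
    ⟪(a • EuclideanSpace.single 0 1 + b • EuclideanSpace.single 1 1 + c • EuclideanSpace.single 2 1 :
        EuclideanSpace ℝ (Fin 3)),
      a' • EuclideanSpace.single 0 1 + b' • EuclideanSpace.single 1 1 + c' • EuclideanSpace.single 2 1⟫ =
      a * a' + b * b' + c * c' := by
  simp [PiLp.inner_apply, Fin.sum_univ_three]
  ring

/-- `‖a e₀ + b e₁ + c e₂‖² = a² + b² + c²`. [folklore] -/
theorem norm_sq_combo_three (a b c : ℝ) :
    ‖(a • EuclideanSpace.single 0 1 + b • EuclideanSpace.single 1 1 + c • EuclideanSpace.single 2 1 :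
        EuclideanSpace ℝ (Fin 3))‖ ^ 2 = a ^ 2 + b ^ 2 + c ^ 2 := by
  rw [← real_inner_self_eq_norm_sq, inner_combo_three]; ring

end Carrier

/-! ### The energy balance -/

namespace IsTaoSolutionOn

variable {T ν : ℝ} {u₀ : EuclideanSpace ℝ (Fin 3) → EuclideanSpace ℝ (Fin 3)}
  {u : ℝ → EuclideanSpace ℝ (Fin 3) → EuclideanSpace ℝ (Fin 3)} {p : ℝ → EuclideanSpace ℝ (Fin 3) → ℝ}

/-- **The energy balance of `E = ‖V²‖² + ‖Ω‖²` in Tao's class.** For a Tao-class solution with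
axisymmetric slices, `E(t) = ∫ ((x₀² + x₁²) Φ(t)⁴ + Ω(t)²)` is continuous on `[0, T]` and
`E(b) = E(0) + ∫₀ᵇ (4 ∫ (x₀² + x₁²) Φ³ Φ' + 2 ∫ Ω Ω')` for `b ∈ (0, T]`, where `Φ = angVelQuot (u t)`,
`Ω = angVortQuot (u t)`, `Φ' = angVelQuot (∂ₜu t)`, `Ω' = angVortQuot (∂ₜu t)` (`∂ₜ` within `[0, T]`).
[cite: LeiZhang2017, §4 (7-1)–(7-2) (p. 10)] -/
theorem energy_balance (h : IsTaoSolutionOn T ν u₀ u p) (hT : 0 < T)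
    (hax : ∀ t ∈ Icc 0 T, IsAxisymmetric (u t)) :
    ContinuousOn (fun t => ∫ x, ((x 0 ^ 2 + x 1 ^ 2) * angVelQuot (u t) x ^ 4 + angVortQuot (u t) x ^ 2))
      (Icc 0 T) ∧
    IntegrableOn (fun t => 4 * (∫ x, (x 0 ^ 2 + x 1 ^ 2) * angVelQuot (u t) x ^ 3 *
          angVelQuot (FluidPDE.timeDerivWithin (Icc 0 T) u t) x) +
        2 * ∫ x, angVortQuot (u t) x * angVortQuot (FluidPDE.timeDerivWithin (Icc 0 T) u t) x)
      (Ioo 0 T) volume ∧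
    ∀ b ∈ Ioc 0 T, ∫ x, ((x 0 ^ 2 + x 1 ^ 2) * angVelQuot (u b) x ^ 4 + angVortQuot (u b) x ^ 2) =
      (∫ x, ((x 0 ^ 2 + x 1 ^ 2) * angVelQuot (u 0) x ^ 4 + angVortQuot (u 0) x ^ 2)) +
      ∫ t in (0 : ℝ)..b, (4 * (∫ x, (x 0 ^ 2 + x 1 ^ 2) * angVelQuot (u t) x ^ 3 *
          angVelQuot (FluidPDE.timeDerivWithin (Icc 0 T) u t) x) +
        2 * ∫ x, angVortQuot (u t) x * angVortQuot (FluidPDE.timeDerivWithin (Icc 0 T) u t) x) := by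
  have hcl := h.classical
  have hsm : IsSmoothSpaceTimeOn (Icc 0 T) u := hcl.smooth_velocity
  have hU : UniqueDiffOn ℝ (Icc 0 T) := uniqueDiffOn_Icc hT
  have hcvx : Convex ℝ (Icc 0 T) := convex_Icc 0 T
  have hIcl : Icc 0 T ⊆ closure (interior (Icc 0 T)) := by rw [interior_Icc, closure_Ioo hT.ne]
  -- the families
  set Φf : ℝ → EuclideanSpace ℝ (Fin 3) → ℝ := fun t => angVelQuot (u t) with hΦf
  set Ωf : ℝ → EuclideanSpace ℝ (Fin 3) → ℝ := fun t => angVortQuot (u t) with hΩf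
  set Φ'f : ℝ → EuclideanSpace ℝ (Fin 3) → ℝ := fun t => angVelQuot (FluidPDE.timeDerivWithin (Icc 0 T) u t)
    with hΦ'f
  set Ω'f : ℝ → EuclideanSpace ℝ (Fin 3) → ℝ := fun t => angVortQuot (FluidPDE.timeDerivWithin (Icc 0 T) u t)
    with hΩ'f
  have hΦs : IsSmoothSpaceTimeOn (Icc 0 T) Φf := hsm.angVelQuot_family hcvx hU
  have hΩs : IsSmoothSpaceTimeOn (Icc 0 T) Ωf := hsm.angVortQuot_family hcvx hU
  have hΦ' : ∀ t ∈ Icc 0 T, ∀ x, FluidPDE.timeDerivWithin (Icc 0 T) Φf t x = Φ'f t x := fun t ht x =>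
    hsm.timeDerivWithin_angVelQuot hcvx hU hax ht x
  have hΩ' : ∀ t ∈ Icc 0 T, ∀ x, FluidPDE.timeDerivWithin (Icc 0 T) Ωf t x = Ω'f t x := fun t ht x =>
    hsm.timeDerivWithin_angVortQuot hcvx hU hIcl hax ht x
  -- the carrier field
  set e0 : EuclideanSpace ℝ (Fin 3) := EuclideanSpace.single 0 1 with he0
  set e1 : EuclideanSpace ℝ (Fin 3) := EuclideanSpace.single 1 1 with he1
  set e2 : EuclideanSpace ℝ (Fin 3) := EuclideanSpace.single 2 1 with he2
  set w : ℝ → EuclideanSpace ℝ (Fin 3) → EuclideanSpace ℝ (Fin 3) := fun t x =>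
    (x 0 * Φf t x ^ 2) • e0 + (x 1 * Φf t x ^ 2) • e1 + Ωf t x • e2 with hw
  have hws : IsSmoothSpaceTimeOn (Icc 0 T) w := by
    have hΦu : ContDiffOn ℝ ∞ (fun z : ℝ × EuclideanSpace ℝ (Fin 3) => Φf z.1 z.2) (Icc 0 T ×ˢ univ) := hΦs
    have hΩu : ContDiffOn ℝ ∞ (fun z : ℝ × EuclideanSpace ℝ (Fin 3) => Ωf z.1 z.2) (Icc 0 T ×ˢ univ) := hΩs
    have hx : ∀ i : Fin 3, ContDiffOn ℝ ∞ (fun z : ℝ × EuclideanSpace ℝ (Fin 3) => z.2 i) (Icc 0 T ×ˢ univ) :=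
      fun i => ((contDiff_piLp_apply (𝕜 := ℝ) (p := 2) (n := ∞) (i := i)).comp contDiff_snd).contDiffOn
    exact ((((hx 0).mul (hΦu.pow 2)).smul contDiffOn_const).add
      (((hx 1).mul (hΦu.pow 2)).smul contDiffOn_const)).add (hΩu.smul contDiffOn_const)
  -- the time derivative of the carrier
  have hw' : ∀ t ∈ Icc 0 T, ∀ x, FluidPDE.timeDerivWithin (Icc 0 T) w t x =
      (x 0 * (2 * Φf t x * Φ'f t x)) • e0 + (x 1 * (2 * Φf t x * Φ'f t x)) • e1 + Ω'f t x • e2 := by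
    intro t ht x
    have hΦd : HasDerivWithinAt (fun s => Φf s x) (Φ'f t x) (Icc 0 T) t := by
      have := hΦs.hasDerivWithinAt_timeDerivWithin hU ht x
      rwa [hΦ' t ht x] at this
    have hΩd : HasDerivWithinAt (fun s => Ωf s x) (Ω'f t x) (Icc 0 T) t := by
      have := hΩs.hasDerivWithinAt_timeDerivWithin hU ht x
      rwa [hΩ' t ht x] at this
    have h2 : HasDerivWithinAt (fun s => Φf s x ^ 2) (2 * Φf t x * Φ'f t x) (Icc 0 T) t := by
      have := hΦd.fun_pow 2
      simpa [pow_one] using this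
    have hsum := (((h2.const_mul (x 0)).smul_const e0).add ((h2.const_mul (x 1)).smul_const e1)).add
      (hΩd.smul_const e2)
    simp only [timeDerivWithin_apply]
    exact hsum.derivWithin (hU t ht)
  ------------------------------------------------------------------
  -- uniform `L²` bounds for `w` and `∂ₜw`
  ------------------------------------------------------------------
  obtain ⟨B, -, hB⟩ := h.exists_bound_velocity
  have hsmooth : ∀ t ∈ Icc 0 T, ContDiff ℝ ∞ (u t) := fun t ht => hcl.contDiff_velocity ht
  have hsmooth' : ∀ t ∈ Icc 0 T, ContDiff ℝ ∞ (FluidPDE.timeDerivWithin (Icc 0 T) u t) := fun t ht =>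
    hsm.contDiff_timeDerivWithin_slice hU ht
  have hax' : ∀ t ∈ Icc 0 T, IsAxisymmetric (FluidPDE.timeDerivWithin (Icc 0 T) u t) := fun t ht =>
    hsm.isAxisymmetric_timeDerivWithin hax ht
  obtain ⟨CΦ, hCΦ⟩ := exists_lintegral_sq_iteratedFDeriv_angVelQuot_le hsmooth hax h.sobolev 0
  obtain ⟨CΩ, hCΩ⟩ := exists_lintegral_sq_iteratedFDeriv_angVortQuot_le hsmooth hax h.sobolev 0
  obtain ⟨CΦ', hCΦ'⟩ := exists_lintegral_sq_iteratedFDeriv_angVelQuot_le hsmooth' hax' h.sobolev_dt 0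
  obtain ⟨CΩ', hCΩ'⟩ := exists_lintegral_sq_iteratedFDeriv_angVortQuot_le hsmooth' hax' h.sobolev_dt 0
  have hB₂ : ∀ t ∈ Icc 0 T, ∀ x : EuclideanSpace ℝ (Fin 3), (x 0 ^ 2 + x 1 ^ 2) * Φf t x ^ 2 ≤ B ^ 2 :=
    fun t ht x => ((hax t ht).horizSq_mul_angVelQuot_sq_le ((hsmooth t ht).of_le (by norm_cast)) x).trans
      (pow_le_pow_left₀ (norm_nonneg _) (hB t ht x) 2)
  have zero_enorm : ∀ {f : EuclideanSpace ℝ (Fin 3) → ℝ} (x), ‖iteratedFDeriv ℝ 0 f x‖ₑ = ‖f x‖ₑ := fun x => by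
    rw [← ofReal_norm, norm_iteratedFDeriv_zero, ofReal_norm]
  have hnw : ∀ t x, ‖w t x‖ ^ 2 = (x 0 ^ 2 + x 1 ^ 2) * Φf t x ^ 4 + Ωf t x ^ 2 := fun t x => by
    simp only [hw]; rw [norm_sq_combo_three]; ring
  have hnw' : ∀ t ∈ Icc 0 T, ∀ x, ‖FluidPDE.timeDerivWithin (Icc 0 T) w t x‖ ^ 2 =
      4 * ((x 0 ^ 2 + x 1 ^ 2) * Φf t x ^ 2) * Φ'f t x ^ 2 + Ω'f t x ^ 2 := fun t ht x => by
    rw [hw' t ht x, norm_sq_combo_three]; ring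
  have hC₀ : ∀ t ∈ Icc 0 T, ∫⁻ x, ‖w t x‖ₑ ^ 2 ≤ Real.toNNReal (B ^ 2) * CΦ + CΩ := by
    intro t ht
    have hpt : ∀ x, ‖w t x‖ₑ ^ 2 ≤ ENNReal.ofReal (B ^ 2) * ‖Φf t x‖ₑ ^ 2 + ‖Ωf t x‖ₑ ^ 2 := by
      intro x
      have h1 : ‖w t x‖ ^ 2 ≤ B ^ 2 * Φf t x ^ 2 + Ωf t x ^ 2 := by
        rw [hnw]
        have := hB₂ t ht x
        nlinarith [sq_nonneg (Φf t x)]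
      calc ‖w t x‖ₑ ^ 2 = ENNReal.ofReal (‖w t x‖ ^ 2) := by rw [← ofReal_norm, ENNReal.ofReal_pow (norm_nonneg _)]
        _ ≤ ENNReal.ofReal (B ^ 2 * Φf t x ^ 2 + Ωf t x ^ 2) := ENNReal.ofReal_le_ofReal h1
        _ = _ := by
          rw [ENNReal.ofReal_add (by positivity) (sq_nonneg _), ENNReal.ofReal_mul (sq_nonneg _),
            ← sq_abs (Φf t x), ← sq_abs (Ωf t x), ENNReal.ofReal_pow (abs_nonneg _),
            ENNReal.ofReal_pow (abs_nonneg _), ← Real.norm_eq_abs, ← Real.norm_eq_abs, ofReal_norm, ofReal_norm]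
    calc ∫⁻ x, ‖w t x‖ₑ ^ 2 ≤ ∫⁻ x, (ENNReal.ofReal (B ^ 2) * ‖Φf t x‖ₑ ^ 2 + ‖Ωf t x‖ₑ ^ 2) := lintegral_mono hpt
      _ = ENNReal.ofReal (B ^ 2) * (∫⁻ x, ‖Φf t x‖ₑ ^ 2) + ∫⁻ x, ‖Ωf t x‖ₑ ^ 2 := by
          rw [lintegral_add_right _ ((hΩs.contDiff_slice ht).continuous.measurable.enorm.pow_const _),
            lintegral_const_mul' _ _ ENNReal.ofReal_ne_top]
      _ ≤ ENNReal.ofReal (B ^ 2) * CΦ + CΩ := by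
          gcongr
          · exact le_of_eq_of_le (lintegral_congr fun x => by rw [zero_enorm]) (hCΦ t ht)
          · exact le_of_eq_of_le (lintegral_congr fun x => by rw [zero_enorm]) (hCΩ t ht)
      _ = _ := rfl
  have hC₁ : ∀ t ∈ Icc 0 T, ∫⁻ x, ‖FluidPDE.timeDerivWithin (Icc 0 T) w t x‖ₑ ^ 2 ≤
      Real.toNNReal (4 * B ^ 2) * CΦ' + CΩ' := by
    intro t ht
    have hpt : ∀ x, ‖FluidPDE.timeDerivWithin (Icc 0 T) w t x‖ₑ ^ 2 ≤
        ENNReal.ofReal (4 * B ^ 2) * ‖Φ'f t x‖ₑ ^ 2 + ‖Ω'f t x‖ₑ ^ 2 := by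
      intro x
      have h1 : ‖FluidPDE.timeDerivWithin (Icc 0 T) w t x‖ ^ 2 ≤ 4 * B ^ 2 * Φ'f t x ^ 2 + Ω'f t x ^ 2 := by
        rw [hnw' t ht x]
        have := hB₂ t ht x
        nlinarith [sq_nonneg (Φ'f t x)]
      calc ‖FluidPDE.timeDerivWithin (Icc 0 T) w t x‖ₑ ^ 2
          = ENNReal.ofReal (‖FluidPDE.timeDerivWithin (Icc 0 T) w t x‖ ^ 2) := by
            rw [← ofReal_norm, ENNReal.ofReal_pow (norm_nonneg _)]
        _ ≤ ENNReal.ofReal (4 * B ^ 2 * Φ'f t x ^ 2 + Ω'f t x ^ 2) := ENNReal.ofReal_le_ofReal h1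
        _ = _ := by
          rw [ENNReal.ofReal_add (by positivity) (sq_nonneg _), ENNReal.ofReal_mul (by positivity),
            ← sq_abs (Φ'f t x), ← sq_abs (Ω'f t x), ENNReal.ofReal_pow (abs_nonneg _),
            ENNReal.ofReal_pow (abs_nonneg _), ← Real.norm_eq_abs, ← Real.norm_eq_abs, ofReal_norm, ofReal_norm]
    have hmeas : Measurable fun x => ‖Ω'f t x‖ₑ ^ 2 :=
      (contDiff_angVortQuot_of_contDiff (hsmooth' t ht)).continuous.measurable.enorm.pow_const _
    calc ∫⁻ x, ‖FluidPDE.timeDerivWithin (Icc 0 T) w t x‖ₑ ^ 2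
        ≤ ∫⁻ x, (ENNReal.ofReal (4 * B ^ 2) * ‖Φ'f t x‖ₑ ^ 2 + ‖Ω'f t x‖ₑ ^ 2) := lintegral_mono hpt
      _ = ENNReal.ofReal (4 * B ^ 2) * (∫⁻ x, ‖Φ'f t x‖ₑ ^ 2) + ∫⁻ x, ‖Ω'f t x‖ₑ ^ 2 := by
          rw [lintegral_add_right _ hmeas, lintegral_const_mul' _ _ ENNReal.ofReal_ne_top]
      _ ≤ ENNReal.ofReal (4 * B ^ 2) * CΦ' + CΩ' := by
          gcongr
          · exact le_of_eq_of_le (lintegral_congr fun x => by rw [zero_enorm]) (hCΦ' t ht)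
          · exact le_of_eq_of_le (lintegral_congr fun x => by rw [zero_enorm]) (hCΩ' t ht)
      _ = _ := rfl
  ------------------------------------------------------------------
  -- the balance
  ------------------------------------------------------------------
  obtain ⟨hint, hcont, hbal⟩ := hws.l2_balance hT hC₀ hC₁
  have hE : ∀ t, (∫ x, ‖w t x‖ ^ 2) = ∫ x, ((x 0 ^ 2 + x 1 ^ 2) * Φf t x ^ 4 + Ωf t x ^ 2) := fun t =>
    integral_congr_ae (ae_of_all _ fun x => hnw t x)
  obtain ⟨BΦ, -, hBΦ⟩ := exists_forall_norm_iteratedFDeriv_angVelQuot_le hsmooth hax h.sobolev 0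
  -- the integrand identity at every time of the slab
  have hden : ∀ t ∈ Icc 0 T, ∫ x, 2 * ⟪w t x, FluidPDE.timeDerivWithin (Icc 0 T) w t x⟫ =
      4 * (∫ x, (x 0 ^ 2 + x 1 ^ 2) * Φf t x ^ 3 * Φ'f t x) + 2 * ∫ x, Ωf t x * Ω'f t x := by
    intro t htI
    have hinner : ∀ x, 2 * ⟪w t x, FluidPDE.timeDerivWithin (Icc 0 T) w t x⟫ =
        4 * ((x 0 ^ 2 + x 1 ^ 2) * Φf t x ^ 3 * Φ'f t x) + 2 * (Ωf t x * Ω'f t x) := by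
      intro x
      rw [hw' t htI x]
      simp only [hw]
      rw [inner_combo_three]
      ring
    rw [integral_congr_ae (ae_of_all _ hinner)]
    have hut : ContDiff ℝ ∞ (u t) := hsmooth t htI
    have hH : ∀ n : ℕ, ∫⁻ x, ‖iteratedFDeriv ℝ n (u t) x‖ₑ ^ 2 < ⊤ := fun n => by
      obtain ⟨C, hC⟩ := h.sobolev n; exact (hC t htI).trans_lt ENNReal.coe_lt_top
    have hHt : ∀ n : ℕ, ∫⁻ x, ‖iteratedFDeriv ℝ n (FluidPDE.timeDerivWithin (Icc 0 T) u t) x‖ₑ ^ 2 < ⊤ := fun n => by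
      obtain ⟨C, hC⟩ := h.sobolev_dt n; exact (hC t htI).trans_lt ENNReal.coe_lt_top
    have mΦ : MemLp (Φf t) 2 volume := memLp_of_sobolev (contDiff_angVelQuot_of_contDiff hut)
      ((hax t htI).lintegral_sq_iteratedFDeriv_angVelQuot_lt_top hut hH)
    have mΩ : MemLp (Ωf t) 2 volume := memLp_of_sobolev (contDiff_angVortQuot_of_contDiff hut)
      ((hax t htI).lintegral_sq_iteratedFDeriv_angVortQuot_lt_top hut hH)
    have mΦ' : MemLp (Φ'f t) 2 volume := memLp_of_sobolev (contDiff_angVelQuot_of_contDiff (hsmooth' t htI))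
      ((hax' t htI).lintegral_sq_iteratedFDeriv_angVelQuot_lt_top (hsmooth' t htI) hHt)
    have mΩ' : MemLp (Ω'f t) 2 volume := memLp_of_sobolev (contDiff_angVortQuot_of_contDiff (hsmooth' t htI))
      ((hax' t htI).lintegral_sq_iteratedFDeriv_angVortQuot_lt_top (hsmooth' t htI) hHt)
    have cP : Continuous fun x : EuclideanSpace ℝ (Fin 3) => (x 0 ^ 2 + x 1 ^ 2) * Φf t x ^ 2 :=
      (contDiff_horizSq (n := 0)).continuous.mul ((contDiff_angVelQuot_of_contDiff hut).continuous.pow 2)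
    have bP : ∀ x : EuclideanSpace ℝ (Fin 3), ‖(x 0 ^ 2 + x 1 ^ 2) * Φf t x ^ 2‖ ≤ B ^ 2 := fun x => by
      rw [Real.norm_of_nonneg (by positivity)]; exact hB₂ t htI x
    have iI1 : Integrable (fun x : EuclideanSpace ℝ (Fin 3) => (x 0 ^ 2 + x 1 ^ 2) * Φf t x ^ 3 * Φ'f t x) volume := by
      have i1 : Integrable (fun x => Φf t x * Φ'f t x) volume := mΦ.integrable_mul mΦ'
      exact (i1.bdd_mul cP.aestronglyMeasurable (ae_of_all _ bP)).congr (ae_of_all _ fun x => by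
        simp only; ring)
    have iI2 : Integrable (fun x => Ωf t x * Ω'f t x) volume := mΩ.integrable_mul mΩ'
    rw [integral_add (iI1.const_mul 4) (iI2.const_mul 2), integral_const_mul, integral_const_mul]
  refine ⟨hcont.congr fun t _ => (hE t).symm, ?_, fun b hb => ?_⟩
  · exact hint.congr_fun (fun t ht => hden t (Ioo_subset_Icc_self ht)) measurableSet_Ioo
  · have hb' := hbal b hb
    rw [hE, hE] at hb'
    rw [hb']
    congr 1
    refine intervalIntegral.integral_congr fun t ht => ?_
    rw [uIcc_of_le hb.1.le] at ht
    exact hden t ⟨ht.1, ht.2.trans hb.2⟩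

/-- **Lei–Zhang 2017, Thm. 1.4, the continuity argument** (arXiv p. 10: "`d/dt (‖V²‖² + ‖Ω‖²) ≤ 0`
… by the standard continuation method `‖V²‖² + ‖Ω‖² ≤ ‖V₀²‖² + ‖Ω₀‖²` for all `t ≥ 0`"), in Tao's
class with `ν = 1`.  Let `(u, p)` be a Tao-class solution on `[0, T]` from `u₀` with axisymmetric
slices, `|Γ₀| ≤ M`, `Γ₀ ∈ L²`, and let `L > E(0)` with `C_A (L · M² ‖Γ₀‖²_{L²})^{1/4} ≤ 1/3`, where
`E(t) = ∫ ((x₀² + x₁²)Φ(t)⁴ + Ω(t)²) = ‖V²(t)‖² + ‖Ω(t)‖²`.  Then `E(t) ≤ E(0)` for all `t ∈ [0, T]`,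
and at every `t ∈ [0, T]` the energy density obeys
`4∫r²Φ³Φ' + 2∫ΩΩ' ≤ −½ ∫ |∇Ω(t)|²`. [cite: LeiZhang2017, §4 (p. 10), Thm. 1.4 first alternative] -/
theorem smallSwirl_energy_le (h : IsTaoSolutionOn T 1 u₀ u p) (hT : 0 < T)
    (hax : ∀ t ∈ Icc 0 T, IsAxisymmetric (u t)) {M : ℝ} (hM : ∀ x, |swirl u₀ x| ≤ M)
    (hΓ0 : ∫⁻ x, ‖swirl u₀ x‖ₑ ^ 2 < ⊤) {L : ℝ}
    (hL : (∫ x, ((x 0 ^ 2 + x 1 ^ 2) * angVelQuot u₀ x ^ 4 + angVortQuot u₀ x ^ 2)) < L)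
    (hsmall : (Real.sqrt newtonNearSqInt + newtonFarLaplacianL65 *
        SNormLESNormFDerivOfEqConst ℝ (volume : Measure (EuclideanSpace ℝ (Fin 3))) 2) *
      Real.sqrt (Real.sqrt (L * (M ^ 2 * ∫ x, swirl u₀ x ^ 2))) ≤ 1 / 3) :
    (∀ t ∈ Icc 0 T, ∫ x, ((x 0 ^ 2 + x 1 ^ 2) * angVelQuot (u t) x ^ 4 + angVortQuot (u t) x ^ 2) ≤
      ∫ x, ((x 0 ^ 2 + x 1 ^ 2) * angVelQuot u₀ x ^ 4 + angVortQuot u₀ x ^ 2)) ∧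
    ∀ t ∈ Icc 0 T,
      4 * (∫ x, (x 0 ^ 2 + x 1 ^ 2) * angVelQuot (u t) x ^ 3 *
          angVelQuot (FluidPDE.timeDerivWithin (Icc 0 T) u t) x) +
        2 * (∫ x, angVortQuot (u t) x * angVortQuot (FluidPDE.timeDerivWithin (Icc 0 T) u t) x) ≤
      -(1 / 2) * ∫ x, (fderiv ℝ (angVortQuot (u t)) x (EuclideanSpace.single 0 1) ^ 2 +
          fderiv ℝ (angVortQuot (u t)) x (EuclideanSpace.single 1 1) ^ 2 +
          fderiv ℝ (angVortQuot (u t)) x (EuclideanSpace.single 2 1) ^ 2) := by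
  obtain ⟨hcont, -, hbal⟩ := h.energy_balance hT hax
  -- notation for the energy and its density
  set E : ℝ → ℝ := fun t => ∫ x, ((x 0 ^ 2 + x 1 ^ 2) * angVelQuot (u t) x ^ 4 + angVortQuot (u t) x ^ 2)
    with hE_def
  set dens : ℝ → ℝ := fun t => 4 * (∫ x, (x 0 ^ 2 + x 1 ^ 2) * angVelQuot (u t) x ^ 3 *
      angVelQuot (FluidPDE.timeDerivWithin (Icc 0 T) u t) x) +
    2 * ∫ x, angVortQuot (u t) x * angVortQuot (FluidPDE.timeDerivWithin (Icc 0 T) u t) x with hdens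
  set X : ℝ → ℝ := fun t => ∫ x, (fderiv ℝ (angVortQuot (u t)) x (EuclideanSpace.single 0 1) ^ 2 +
      fderiv ℝ (angVortQuot (u t)) x (EuclideanSpace.single 1 1) ^ 2 +
      fderiv ℝ (angVortQuot (u t)) x (EuclideanSpace.single 2 1) ^ 2) with hX_def
  have hE0 : E 0 = ∫ x, ((x 0 ^ 2 + x 1 ^ 2) * angVelQuot u₀ x ^ 4 + angVortQuot u₀ x ^ 2) := by
    simp only [hE_def, h.initial]
  rw [← hE0] at hL ⊢
  -- the a-priori bounds of `Γ`
  have hcl := h.classical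
  have hMt : ∀ s ∈ Icc 0 T, ∀ x, |swirl (u s) x| ≤ M := h.abs_swirl_le one_pos hT hax hM
  have hGt : ∀ s ∈ Icc 0 T, ∫⁻ x, ‖swirl (u s) x‖ₑ ^ 2 ≤ ∫⁻ x, ‖swirl u₀ x‖ₑ ^ 2 := fun s hs =>
    h.lintegral_swirl_sq_le one_pos hT hax hM hΓ0 hs
  have hG0 : 0 ≤ ∫ x, swirl u₀ x ^ 2 := integral_nonneg fun x => sq_nonneg _
  have hu0 : ContDiff ℝ ∞ u₀ := by rw [← h.initial]; exact hcl.contDiff_velocity ⟨le_rfl, hT.le⟩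
  have hΓ2 : ∀ s ∈ Icc 0 T, MemLp (swirl (u s)) 2 volume := fun s hs =>
    ⟨(contDiff_swirl (hcl.contDiff_velocity hs)).continuous.aestronglyMeasurable,
      eLpNorm_two_lt_top_of_lintegral_enorm_sq_lt_top ((hGt s hs).trans_lt hΓ0)⟩
  have hGreal : ∀ s ∈ Icc 0 T, ∫ x, swirl (u s) x ^ 2 ≤ ∫ x, swirl u₀ x ^ 2 := by
    intro s hs
    have h1 : ∫ x, swirl (u s) x ^ 2 = (∫⁻ x, ‖swirl (u s) x‖ₑ ^ 2).toReal := by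
      rw [integral_eq_lintegral_of_nonneg_ae (ae_of_all _ fun x => sq_nonneg _)
        ((contDiff_swirl (hcl.contDiff_velocity hs)).continuous.pow 2).aestronglyMeasurable]
      congr 1; exact lintegral_congr fun x => by
        rw [← ofReal_norm, Real.norm_eq_abs, ← ENNReal.ofReal_pow (abs_nonneg _), sq_abs]
    have h2 : ∫ x, swirl u₀ x ^ 2 = (∫⁻ x, ‖swirl u₀ x‖ₑ ^ 2).toReal := by
      rw [integral_eq_lintegral_of_nonneg_ae (ae_of_all _ fun x => sq_nonneg _)
        ((contDiff_swirl hu0).continuous.pow 2).aestronglyMeasurable]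
      congr 1; exact lintegral_congr fun x => by
        rw [← ofReal_norm, Real.norm_eq_abs, ← ENNReal.ofReal_pow (abs_nonneg _), sq_abs]
    rw [h1, h2]
    exact ENNReal.toReal_mono hΓ0.ne (hGt s hs)
  -- the slice inequality wherever `E ≤ L`
  have hBq_le : ∀ s ∈ Icc 0 T, ∫ x, angVortQuot (u s) x ^ 2 ≤ E s := by
    intro s hs
    have hus : ContDiff ℝ ∞ (u s) := hcl.contDiff_velocity hs
    have hH : ∀ n : ℕ, ∫⁻ x, ‖iteratedFDeriv ℝ n (u s) x‖ₑ ^ 2 < ⊤ := fun n => by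
      obtain ⟨C, hC⟩ := h.sobolev n; exact (hC s hs).trans_lt ENNReal.coe_lt_top
    have mΩ : MemLp (angVortQuot (u s)) 2 volume := memLp_of_sobolev (contDiff_angVortQuot_of_contDiff hus)
      ((hax s hs).lintegral_sq_iteratedFDeriv_angVortQuot_lt_top hus hH)
    have mΦ : MemLp (angVelQuot (u s)) 2 volume := memLp_of_sobolev (contDiff_angVelQuot_of_contDiff hus)
      ((hax s hs).lintegral_sq_iteratedFDeriv_angVelQuot_lt_top hus hH)
    obtain ⟨B, -, hB⟩ := h.exists_bound_velocity
    have hB₂ : ∀ x : EuclideanSpace ℝ (Fin 3), (x 0 ^ 2 + x 1 ^ 2) * angVelQuot (u s) x ^ 2 ≤ B ^ 2 := fun x =>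
      ((hax s hs).horizSq_mul_angVelQuot_sq_le (hus.of_le (by norm_cast)) x).trans
        (pow_le_pow_left₀ (norm_nonneg _) (hB s hs x) 2)
    have cP : Continuous fun x : EuclideanSpace ℝ (Fin 3) => (x 0 ^ 2 + x 1 ^ 2) * angVelQuot (u s) x ^ 2 :=
      (contDiff_horizSq (n := 0)).continuous.mul ((contDiff_angVelQuot_of_contDiff hus).continuous.pow 2)
    have iA : Integrable (fun x : EuclideanSpace ℝ (Fin 3) => (x 0 ^ 2 + x 1 ^ 2) * angVelQuot (u s) x ^ 4) volume :=
      (mΦ.integrable_sq.bdd_mul cP.aestronglyMeasurable (ae_of_all _ fun x => by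
        rw [Real.norm_of_nonneg (by positivity)]; exact hB₂ x)).congr (ae_of_all _ fun x => by simp only; ring)
    simp only [hE_def]
    rw [integral_add iA mΩ.integrable_sq]
    have hA0 : 0 ≤ ∫ x : EuclideanSpace ℝ (Fin 3), (x 0 ^ 2 + x 1 ^ 2) * angVelQuot (u s) x ^ 4 :=
      integral_nonneg fun x => by positivity
    linarith
  have hslice : ∀ s ∈ Icc 0 T, E s ≤ L → dens s ≤ -(1 / 2) * X s := by
    intro s hs hEs
    have hsm' : (Real.sqrt newtonNearSqInt + newtonFarLaplacianL65 *
        SNormLESNormFDerivOfEqConst ℝ (volume : Measure (EuclideanSpace ℝ (Fin 3))) 2) *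
        Real.sqrt (Real.sqrt ((∫ x, angVortQuot (u s) x ^ 2) * (M ^ 2 * ∫ x, swirl (u s) x ^ 2))) ≤ 1 / 3 := by
      refine le_trans (mul_le_mul_of_nonneg_left (Real.sqrt_le_sqrt (Real.sqrt_le_sqrt ?_)) ?_) hsmall
      · have h1 : ∫ x, angVortQuot (u s) x ^ 2 ≤ L := (hBq_le s hs).trans hEs
        have h2 : M ^ 2 * ∫ x, swirl (u s) x ^ 2 ≤ M ^ 2 * ∫ x, swirl u₀ x ^ 2 :=
          mul_le_mul_of_nonneg_left (hGreal s hs) (sq_nonneg _)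
        exact mul_le_mul h1 h2 (mul_nonneg (sq_nonneg _) (integral_nonneg fun x => sq_nonneg _))
          ((integral_nonneg fun x => sq_nonneg _).trans h1)
      · have := hsmall
        by_contra hneg
        push Not at hneg
        -- the constant `C_A` is nonnegative: `√N ≥ 0`, `Λ, C_S ≥ 0`
        have : 0 ≤ Real.sqrt newtonNearSqInt + newtonFarLaplacianL65 *
            SNormLESNormFDerivOfEqConst ℝ (volume : Measure (EuclideanSpace ℝ (Fin 3))) 2 := by
          have h1 : 0 ≤ newtonFarLaplacianL65 := newtonFarLaplacianL65_nonneg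
          positivity
        linarith
    have hsl := h.smallSwirl_slice_le hT hax hs (hMt s hs) (hΓ2 s hs) hsm'
    have hDA : 0 ≤ ∫ x, (x 0 ^ 2 + x 1 ^ 2) * angVelQuot (u s) x ^ 2 *
        (fderiv ℝ (angVelQuot (u s)) x (EuclideanSpace.single 0 1) ^ 2 +
          fderiv ℝ (angVelQuot (u s)) x (EuclideanSpace.single 1 1) ^ 2 +
          fderiv ℝ (angVelQuot (u s)) x (EuclideanSpace.single 2 1) ^ 2) :=
      integral_nonneg fun x => by positivity
    simp only [hdens, hX_def]
    linarith
  have hX0 : ∀ s, 0 ≤ X s := fun s => integral_nonneg fun x => by positivity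
  -- decay: if `E ≤ L` on `[0, b]` then `E b ≤ E 0`
  have hdecay : ∀ b ∈ Icc 0 T, (∀ s ∈ Icc 0 b, E s ≤ L) → E b ≤ E 0 := by
    intro b hb hgood
    rcases eq_or_lt_of_le hb.1 with hb0 | hb0
    · rw [← hb0]
    have hb' := hbal b ⟨hb0, hb.2⟩
    have hneg : ∫ t in (0 : ℝ)..b, dens t ≤ 0 := by
      rw [intervalIntegral.integral_of_le hb0.le]
      refine setIntegral_nonpos measurableSet_Ioc fun t ht => ?_
      have htI : t ∈ Icc 0 T := ⟨ht.1.le, ht.2.trans hb.2⟩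
      exact (hslice t htI (hgood t ⟨ht.1.le, ht.2⟩)).trans
        (mul_nonpos_of_nonpos_of_nonneg (by norm_num) (hX0 t))
    simp only [hE_def] at hb' ⊢
    linarith
  -- the continuity argument: `E ≤ L` on the whole slab
  have hgoodall : ∀ t ∈ Icc 0 T, E t ≤ L := by
    by_contra hbad
    push Not at hbad
    set S : Set ℝ := {t | t ∈ Icc 0 T ∧ L < E t} with hS
    have hSne : S.Nonempty := by obtain ⟨t, ht, hlt⟩ := hbad; exact ⟨t, ht, hlt⟩
    have hSbdd : BddBelow S := ⟨0, fun t ht => ht.1.1⟩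
    obtain ⟨t₀, ht₀⟩ : ∃ t₀, t₀ = sInf S := ⟨_, rfl⟩
    have ht₀I : t₀ ∈ Icc 0 T := by
      obtain ⟨t, ht⟩ := id hSne
      exact ⟨ht₀ ▸ le_csInf hSne fun s hs => hs.1.1, (ht₀ ▸ csInf_le hSbdd ht).trans ht.1.2⟩
    have hbelow : ∀ s ∈ Icc 0 T, s < t₀ → E s ≤ L := by
      intro s hs hst
      by_contra hc
      push Not at hc
      exact absurd (ht₀ ▸ csInf_le hSbdd ⟨hs, hc⟩ : t₀ ≤ s) (not_le.2 hst)
    -- `E t₀ ≤ L`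
    have hEt₀ : E t₀ ≤ L := by
      rcases eq_or_lt_of_le ht₀I.1 with h0 | h0
      · rw [← h0]; exact hL.le
      · -- left limit within the slab
        have hcw : ContinuousWithinAt E (Icc 0 T ∩ Iio t₀) t₀ := (hcont t₀ ht₀I).mono inter_subset_left
        have hmem : t₀ ∈ closure (Icc 0 T ∩ Iio t₀) := by
          have hsub : Ico 0 t₀ ⊆ Icc 0 T ∩ Iio t₀ := fun s hs => ⟨⟨hs.1, hs.2.le.trans ht₀I.2⟩, hs.2⟩
          exact closure_mono hsub (by rw [closure_Ico h0.ne]; exact right_mem_Icc.2 h0.le)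
        haveI : (𝓝[Icc 0 T ∩ Iio t₀] t₀).NeBot := mem_closure_iff_nhdsWithin_neBot.1 hmem
        refine le_of_tendsto hcw ?_
        filter_upwards [self_mem_nhdsWithin] with s hs
        exact hbelow s hs.1 hs.2
    -- decay up to `t₀`, then continuity gives room
    have hEt₀' : E t₀ ≤ E 0 := hdecay t₀ ht₀I fun s hs =>
      (eq_or_lt_of_le hs.2).elim (fun heq => heq ▸ hEt₀) fun hlt => hbelow s ⟨hs.1, hlt.le.trans ht₀I.2⟩ hlt
    have hgap : E t₀ < L := hEt₀'.trans_lt hL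
    obtain ⟨δ, hδ, hδE⟩ : ∃ δ > 0, ∀ s ∈ Icc 0 T, dist s t₀ < δ → E s < L := by
      have hcw := hcont t₀ ht₀I
      have hev : ∀ᶠ s in 𝓝[Icc 0 T] t₀, E s < L := hcw (Iio_mem_nhds hgap)
      obtain ⟨δ, hδ, hsub⟩ := Metric.mem_nhdsWithin_iff.1 hev
      exact ⟨δ, hδ, fun s hs hd => hsub ⟨hd, hs⟩⟩
    -- every point of `S` is `≥ t₀ + δ`
    have hlow : ∀ t ∈ S, t₀ + δ ≤ t := by
      intro t ht
      by_contra hc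
      push Not at hc
      have ht₀t : t₀ ≤ t := ht₀ ▸ csInf_le hSbdd ht
      have hd : dist t t₀ < δ := by
        rw [Real.dist_eq, abs_of_nonneg (by linarith)]; linarith
      exact absurd (hδE t ht.1 hd) (not_lt.2 ht.2.le)
    have : t₀ + δ ≤ t₀ := by rw [ht₀]; exact le_csInf hSne (fun t ht => ht₀ ▸ hlow t ht)
    linarith
  refine ⟨fun t ht => ?_, fun t ht => hslice t ht (hgoodall t ht)⟩
  have := hdecay t ht fun s hs => hgoodall s ⟨hs.1, hs.2.trans ht.2⟩
  simpa only [hE_def] using this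

end IsTaoSolutionOn

end Literature.Analysis.FluidPDE

end
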